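import Summits.AtomisticToContinuum.FouriersLaw.Theses.ContactStieltjesMeasure
import Summits.AtomisticToContinuum.FouriersLaw.Theorems.ContactStieltjesMeasureStieltjesRepresentationStubStieltjesOfPencil
import Summits.AtomisticToContinuum.FouriersLaw.Theorems.ContactStieltjesMeasureStieltjesRepresentationStubHarmonicMember
import Summits.AtomisticToContinuum.FouriersLaw.Theorems.ContactStieltjesMeasureStieltjesRepresentationStubBoundaryGreenKuboNonneg
import Summits.AtomisticToContinuum.FouriersLaw.Theorems.ContactStieltjesMeasureStieltjesRepresentationStubPencilOfGreenKubo
import Literature.MathematicalPhysics.KineticTheory.LangevinChainKernel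

/-!
# Crux `ContactStieltjesMeasure.StieltjesRepresentation` (stmt-AtomisticToContinuum-15248), line `cayley-pencil`:
# the crux on its positive range, and its reduction to the `φ⁴` edge

Support file (`--supports stmt-AtomisticToContinuum-15248`). With the four landed stubs of the `cayley-pencil` skeleton —
`stub_boundaryGreenKuboNonneg` (open-chain Green–Kubo in boundary-power form), `stub_pencilOfGreenKubo` (the dissipative
pencil realising the boundary Green–Kubo function), `stub_stieltjesOfPencil` (Stieltjes representation of a dissipative pencil)
and `stub_harmonicMember` (`lam = β = 0`) — this file proves, sorry-free:

* `representation_pos` / `stub_stieltjesRepresentation_pos` — the crux's clause on the range `0 ≤ lam`, `0 < β` (for every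
  `N ≥ 2` ONE `γ`-free bounded monotone `Φ_N`, vanishing on `(-∞, 0]`, represents the linear response at every friction
  `γ > 0`), i.e. `StieltjesRepresentation` with its hypothesis `0 ≤ β` strengthened to `0 < β`;
* `stieltjesRepresentation_of_phi4Edge` — the crux BY NAME from the single remaining registered stub `stub_phi4Edge`
  (the `φ⁴` edge `β = 0 < lam`: quartic pinning, harmonic coupling, where existence of the steady state is open for `N ≥ 4`).
No definitions, no new facts.
-/

noncomputable section

open scoped NNReal ENNReal Topology
open MeasureTheory Filter Set
open Literature.MathematicalPhysics.KineticTheory.HeatConduction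

namespace Summit.AtomisticToContinuum.FouriersLaw.Theorems.ContactStieltjesMeasure.CayleyPencil

/-- **The crux's clause on `0 ≤ lam`, `0 < β`, one `N` at a time**: boundary Green–Kubo (`stub_boundaryGreenKuboNonneg`) +
the pencil (`stub_pencilOfGreenKubo`) + the Stieltjes representation of a dissipative pencil (`stub_stieltjesOfPencil`) give,
for each `N ≥ 2`, ONE `γ`-free `Φ_N` representing the response at every `γ > 0`.
[cite: LaxPhillips1967, Ch. II §3] [cite: CuneoEckmannHairerReyBellet2018, Thm 2.13] -/
theorem representation_pos {ω₂ lam β : ℝ} (hω : 0 < ω₂) (hl : 0 ≤ lam) (hβ : 0 < β) {T : ℝ} (hT : 0 < T) (N : ℕ)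
    (hN : 2 ≤ N) :
    ∃ ΦN : ℝ → ℝ, Monotone ΦN ∧ (∀ s : ℝ, s ≤ 0 → ΦN s = 0) ∧ (∃ m : ℝ, ∀ s : ℝ, ΦN s ≤ m) ∧
      ∀ γ : ℝ, 0 < γ →
        (∀ (N' : ℕ) (T_L T_R : ℝ), 0 < T_L → 0 < T_R → ∀ μ ν : Measure (PhaseSpace N'),
          (pinnedChain ω₂ lam β γ).IsSteadyState N' T_L T_R μ →
          (pinnedChain ω₂ lam β γ).IsSteadyState N' T_L T_R ν → μ = ν) →
        ∀ μ : (N' : ℕ) → ℝ → ℝ → Measure (PhaseSpace N'),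
          (∀ (N' : ℕ) (T_L T_R : ℝ), 0 < T_L → 0 < T_R →
            (pinnedChain ω₂ lam β γ).IsSteadyState N' T_L T_R (μ N' T_L T_R)) →
          Tendsto (fun δ : ℝ => (pinnedChain ω₂ lam β γ).totalCurrent (μ N (T + δ / 2) (T - δ / 2)) / δ)
            (𝓝[≠] 0)
            (𝓝 (((N : ℝ) - 1) * γ * ∫ t in Set.Ioi (0 : ℝ), ΦN t * (2 * t / (γ ^ 2 + t ^ 2) ^ 2))) := by
  obtain ⟨K, instK, instK', W, g, hR, hE, hlink⟩ := stub_pencilOfGreenKubo ω₂ lam β hω hl hβ T hT N hN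
  obtain ⟨Φ, hmono, hzero, hbound, hrep⟩ := stub_stieltjesOfPencil K W hR hE g
  refine ⟨Φ, hmono, hzero, ⟨‖g‖ ^ 2, hbound⟩, ?_⟩
  intro γ hγ hU μf hμf
  obtain ⟨hint, htend⟩ := stub_boundaryGreenKuboNonneg ω₂ lam β γ hω hl hβ hγ hU μf hμf T hT N hN
  have hval := hlink γ hγ hint
  rw [← hval, hrep γ hγ, ← mul_assoc] at htend
  exact htend

/-- **Registered sub-goal `stub_stieltjesRepresentation_pos`** (this file's ticket): the crux `StieltjesRepresentation`
with `0 ≤ β` strengthened to `0 < β` — for `ω₂ > 0`, `lam ≥ 0`, `β > 0`, `T > 0`, ONE `γ`-free family of bounded monotone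
`Φ_N` (`N ≥ 2`) vanishing on `(-∞,0]` with `totalCurrent(μ_{N,T+δ/2,T-δ/2})/δ → (N-1)·γ·∫₀^∞ Φ_N(t)·2t/(γ²+t²)² dt` for
every `γ > 0`, under weak-NESS uniqueness, along every steady family (`representation_pos` and choice across `N`).
[cite: LaxPhillips1967, Ch. II §3] [cite: CuneoEckmannHairerReyBellet2018, Thm 2.13] -/
theorem stub_stieltjesRepresentation_pos :
    ∀ (ω₂ lam β : ℝ), 0 < ω₂ → 0 ≤ lam → 0 < β → ∀ (T : ℝ), 0 < T → ∃ Φ : ℕ → ℝ → ℝ, ∀ (N : ℕ), 2 ≤ N → Monotone (Φ N) ∧ (∀ s : ℝ, s ≤ 0 → Φ N s = 0) ∧ (∃ m : ℝ, ∀ s : ℝ, Φ N s ≤ m) ∧ ∀ (γ : ℝ), 0 < γ → (∀ (N' : ℕ) (T_L T_R : ℝ), 0 < T_L → 0 < T_R → ∀ (μ ν : MeasureTheory.Measure (Literature.MathematicalPhysics.KineticTheory.HeatConduction.PhaseSpace N')), (Literature.MathematicalPhysics.KineticTheory.HeatConduction.pinnedChain ω₂ lam β γ).IsSteadyState N' T_L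 T_R μ → (Literature.MathematicalPhysics.KineticTheory.HeatConduction.pinnedChain ω₂ lam β γ).IsSteadyState N' T_L T_R ν → μ = ν) → ∀ (μ : (N' : ℕ) → ℝ → ℝ → MeasureTheory.Measure (Literature.MathematicalPhysics.KineticTheory.HeatConduction.PhaseSpace N')), (∀ (N' : ℕ) (T_L T_R : ℝ), 0 < T_L → 0 < T_R → (Literature.MathematicalPhysics.KineticTheory.HeatConduction.pinnedChain ω₂ lam β γ).IsSteadyState N' T_L T_R (μ N' T_L T_R)) → Filter.Tendsto (fun δ : ℝ => (Literature.MathematicalPhysics.KineticTheory.HeatConduction.pinnedChain ω₂ lam β γ).totalCurrent (μ N (T + δ / 2) (T - δ / 2)) / δ) (nhdsWithin 0 {(0 : ℝ)}ᶜ) (nhds (((N : ℝ) - 1) * γ * ∫ t in Set.Ioi (0 : ℝ), Φ N t * (2 * t / (γ ^ 2 + t ^ 2) ^ 2))) := by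
  intro ω₂ lam β hω hl hβ T hT
  classical
  have key := fun (N : ℕ) (hN : 2 ≤ N) => representation_pos hω hl hβ hT N hN
  refine ⟨fun N => if hN : 2 ≤ N then Classical.choose (key N hN) else fun _ => 0, fun N hN => ?_⟩
  simp only [dif_pos hN]
  exact Classical.choose_spec (key N hN)

/-- **The crux from the `φ⁴` edge.** `StieltjesRepresentation` BY NAME, from the one remaining registered stub of the line
(`stub_phi4Edge`: the clause for `pinnedChain ω₂ lam 0 γ`, `0 < lam`): case split on the parameter range — `0 < β` is
`stub_stieltjesRepresentation_pos`, `lam = β = 0` is the landed harmonic member, `β = 0 < lam` is the hypothesis.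
[cite: HairerMattingly2009, §1] -/
theorem stieltjesRepresentation_of_phi4Edge
    (h5 : (∀ ω₂ lam : ℝ, 0 < ω₂ → 0 < lam → ∀ T : ℝ, 0 < T →
      ∃ Φ : ℕ → ℝ → ℝ, ∀ N : ℕ, 2 ≤ N → Monotone (Φ N) ∧ (∀ s : ℝ, s ≤ 0 → Φ N s = 0) ∧
        (∃ m : ℝ, ∀ s : ℝ, Φ N s ≤ m) ∧ ∀ γ : ℝ, 0 < γ →
          (∀ (N' : ℕ) (T_L T_R : ℝ), 0 < T_L → 0 < T_R → ∀ μ ν : Measure (PhaseSpace N'),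
            (pinnedChain ω₂ lam 0 γ).IsSteadyState N' T_L T_R μ →
            (pinnedChain ω₂ lam 0 γ).IsSteadyState N' T_L T_R ν → μ = ν) →
          ∀ μ : (N' : ℕ) → ℝ → ℝ → Measure (PhaseSpace N'),
            (∀ (N' : ℕ) (T_L T_R : ℝ), 0 < T_L → 0 < T_R →
              (pinnedChain ω₂ lam 0 γ).IsSteadyState N' T_L T_R (μ N' T_L T_R)) →
            Tendsto (fun δ : ℝ => (pinnedChain ω₂ lam 0 γ).totalCurrent (μ N (T + δ / 2) (T - δ / 2)) / δ)
              (𝓝[≠] 0)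
              (𝓝 (((N : ℝ) - 1) * γ * ∫ t in Set.Ioi (0 : ℝ), Φ N t * (2 * t / (γ ^ 2 + t ^ 2) ^ 2))))) :
    Summit.AtomisticToContinuum.FouriersLaw.Theses.ContactStieltjesMeasure.StieltjesRepresentation := by
  intro ω₂ lam β hω hl hβ T hT
  rcases hβ.eq_or_lt with hβ0 | hβpos
  · subst hβ0
    rcases hl.eq_or_lt with hl0 | hlpos
    · subst hl0
      exact stub_harmonicMember ω₂ hω T hT
    · exact h5 ω₂ lam hω hlpos T hT
  · exact stub_stieltjesRepresentation_pos ω₂ lam β hω hl hβpos T hT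

end Summit.AtomisticToContinuum.FouriersLaw.Theorems.ContactStieltjesMeasure.CayleyPencil

end
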